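import Mathlib
import HarnessLib
import Summits.ValiantsHypothesis.ValiantsHypothesis.Theorems.LacunarySymmetroidMatrixDescartesOsculationLawPeelBranchUnique

/-!
# ValiantsHypothesis / LacunarySymmetroid — crux `MatrixDescartes` (stmt-ValiantsHypothesis-18050, V1),
# line `Cruxes/MatrixDescartes/Lines/osculation_law.lean` («osculation-law»), stub `stub_peel` (ALL ranks):
# TWO COMPONENTS SHARING A POINT COINCIDE (piece (γ1) of NOTE-p7g12-peel-general-r-sizing.md §6, uniqueness half)

Rank-free.  A COMPONENT (see `…PeelComponent.exists_component`) is a continuous positive solution `β` of `Φ = 0` on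
`(α, ω)`, `0 ≤ α < ω ≤ B`, whose right end is ALIVE at the horizon `B` / ZERO / ESCAPE and whose left end REACHES
`0⁺` / is ZERO / is ESCAPE.  From `branch_unique_of_hyperbolic` (p620085) and the behaviour at the ends:
* `eqOn_of_mem` — two continuous positive solutions agreeing at one common point agree on the common domain;
* `omega_le_of_rightEnd`, `not_rightEnd_of_alive` — a ZERO/ESCAPE right end cannot lie inside, or at the alive
  horizon of, another solution through a common point; `le_alpha_of_leftEnd` — the left mirror;
* **`component_eq`** — two components (same horizon) sharing a point have the same `α`, the same `ω`, and agree on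
  `(α, ω)`.
Honest framing: a rank-free LEMMA toward the OPEN stub `stub_peel` (all `r`); nothing of the summit is proved;
`MatrixDescartes`, the LAW and `VP ≠ VNP` are NOT proved.  No definitions, no named facts.  (val-lit-p4 g13, helper
`--supports stmt-ValiantsHypothesis-18050`; lane of val-lit-p7 g12.)
-/

-- `Summit.ValiantsHypothesis.ValiantsHypothesis.…` is the tree's mandated single-conjunct layout (Sub = Summit).
set_option linter.dupNamespace false

noncomputable section

namespace Summit.ValiantsHypothesis.ValiantsHypothesis.Theorems.LacunarySymmetroidMatrixDescartes

open Polynomial Set Filter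
open MvPolynomial (pderiv)
open scoped BigOperators Topology

namespace OsculationPeel

section

variable (Φ : MvPolynomial (Fin 2) ℝ) (P : ℝ → ℝ[X])
    (hP : ∀ t b, (P t).eval b = MvPolynomial.eval ![t, b] Φ) (hsplit : ∀ t, 0 < t → (P t).Splits)
    (hfin : {p : Fin 2 → ℝ | 0 < p 0 ∧ 0 < p 1 ∧ MvPolynomial.eval p Φ = 0 ∧
      MvPolynomial.eval p
        (MvPolynomial.X 0 * MvPolynomial.pderiv 0 (MvPolynomial.X 0 * MvPolynomial.pderiv 0 Φ)
            * (MvPolynomial.X 1 * MvPolynomial.pderiv 1 Φ) ^ 2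
          - 2 * (MvPolynomial.X 0 * MvPolynomial.pderiv 0 (MvPolynomial.X 1 * MvPolynomial.pderiv 1 Φ))
            * (MvPolynomial.X 0 * MvPolynomial.pderiv 0 Φ) * (MvPolynomial.X 1 * MvPolynomial.pderiv 1 Φ)
          + MvPolynomial.X 1 * MvPolynomial.pderiv 1 (MvPolynomial.X 1 * MvPolynomial.pderiv 1 Φ)
            * (MvPolynomial.X 0 * MvPolynomial.pderiv 0 Φ) ^ 2) = 0}.Finite)
    (hgp : ∀ p ∈ {p : Fin 2 → ℝ | 0 < p 0 ∧ 0 < p 1 ∧ MvPolynomial.eval p Φ = 0 ∧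
      MvPolynomial.eval p
        (MvPolynomial.X 0 * MvPolynomial.pderiv 0 (MvPolynomial.X 0 * MvPolynomial.pderiv 0 Φ)
            * (MvPolynomial.X 1 * MvPolynomial.pderiv 1 Φ) ^ 2
          - 2 * (MvPolynomial.X 0 * MvPolynomial.pderiv 0 (MvPolynomial.X 1 * MvPolynomial.pderiv 1 Φ))
            * (MvPolynomial.X 0 * MvPolynomial.pderiv 0 Φ) * (MvPolynomial.X 1 * MvPolynomial.pderiv 1 Φ)
          + MvPolynomial.X 1 * MvPolynomial.pderiv 1 (MvPolynomial.X 1 * MvPolynomial.pderiv 1 Φ)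
            * (MvPolynomial.X 0 * MvPolynomial.pderiv 0 Φ) ^ 2) = 0},
        MvPolynomial.eval p (MvPolynomial.pderiv 1 Φ) ≠ 0)

include hP hsplit hfin hgp

/-- **Two solutions through a common point agree on the common domain.**  Continuous positive solutions `β₁` on
`(α₁, ω₁)` and `β₂` on `(α₂, ω₂)` (`α₁ ≥ 0`) with `β₁ s = β₂ s` at a common point `s` agree on
`(max α₁ α₂, min ω₁ ω₂)`. [folklore; `branch_unique_of_hyperbolic` on the segment between `s` and the point] -/
theorem eqOn_of_mem {α₁ ω₁ α₂ ω₂ : ℝ} {β₁ β₂ : ℝ → ℝ} (hα₁ : 0 ≤ α₁)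
    (hc₁ : ContinuousOn β₁ (Ioo α₁ ω₁)) (hs₁ : ∀ t ∈ Ioo α₁ ω₁, 0 < β₁ t ∧ MvPolynomial.eval ![t, β₁ t] Φ = 0)
    (hc₂ : ContinuousOn β₂ (Ioo α₂ ω₂)) (hs₂ : ∀ t ∈ Ioo α₂ ω₂, 0 < β₂ t ∧ MvPolynomial.eval ![t, β₂ t] Φ = 0)
    {s : ℝ} (hs1 : s ∈ Ioo α₁ ω₁) (hs2 : s ∈ Ioo α₂ ω₂) (heq : β₁ s = β₂ s) :
    ∀ u ∈ Ioo (max α₁ α₂) (min ω₁ ω₂), β₁ u = β₂ u := by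
  intro u hu
  obtain ⟨hu12, hu3⟩ := hu
  obtain ⟨hu1, hu2⟩ := max_lt_iff.1 hu12
  rw [lt_min_iff] at hu3
  set lo := min s u with hlo
  set hi := max s u with hhi
  have hlo1 : α₁ < lo := lt_min hs1.1 hu1
  have hlo2 : α₂ < lo := lt_min hs2.1 hu2
  have hhi1 : hi < ω₁ := max_lt hs1.2 hu3.1
  have hhi2 : hi < ω₂ := max_lt hs2.2 hu3.2
  have hsub1 : Icc lo hi ⊆ Ioo α₁ ω₁ := fun x hx => ⟨hlo1.trans_le hx.1, lt_of_le_of_lt hx.2 hhi1⟩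
  have hsub2 : Icc lo hi ⊆ Ioo α₂ ω₂ := fun x hx => ⟨hlo2.trans_le hx.1, lt_of_le_of_lt hx.2 hhi2⟩
  have hsI : s ∈ Icc lo hi := ⟨min_le_left _ _, le_max_left _ _⟩
  have huI : u ∈ Icc lo hi := ⟨min_le_right _ _, le_max_right _ _⟩
  have h := branch_unique_of_hyperbolic Φ P hP hsplit hfin hgp (hα₁.trans_lt hlo1) hsI
    (hc₁.mono hsub1) (hc₂.mono hsub2) (fun t ht => (hs₁ t (hsub1 ht)).1)
    (fun t ht => (hs₁ t (hsub1 ht)).2) (fun t ht => (hs₂ t (hsub2 ht)).2) heq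
  exact h huI

/-- **A right END cannot lie inside another solution through a common point.**  If `β₁` on `(α₁, ω₁)` tends to `0`
or to `+∞` at `ω₁⁻` and `β₂` is a continuous positive solution on `(α₂, ω₂)` agreeing with `β₁` at a common point,
then `ω₂ ≤ ω₁`. [folklore] -/
theorem omega_le_of_rightEnd {α₁ ω₁ α₂ ω₂ : ℝ} {β₁ β₂ : ℝ → ℝ} (hα₁ : 0 ≤ α₁)
    (hc₁ : ContinuousOn β₁ (Ioo α₁ ω₁)) (hs₁ : ∀ t ∈ Ioo α₁ ω₁, 0 < β₁ t ∧ MvPolynomial.eval ![t, β₁ t] Φ = 0)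
    (hend : Tendsto β₁ (𝓝[<] ω₁) (𝓝 0) ∨ Tendsto β₁ (𝓝[<] ω₁) atTop)
    (hc₂ : ContinuousOn β₂ (Ioo α₂ ω₂)) (hs₂ : ∀ t ∈ Ioo α₂ ω₂, 0 < β₂ t ∧ MvPolynomial.eval ![t, β₂ t] Φ = 0)
    {s : ℝ} (hs1 : s ∈ Ioo α₁ ω₁) (hs2 : s ∈ Ioo α₂ ω₂) (heq : β₁ s = β₂ s) : ω₂ ≤ ω₁ := by
  by_contra hlt
  push Not at hlt
  have hω : ω₁ ∈ Ioo α₂ ω₂ := ⟨hs2.1.trans hs1.2, hlt⟩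
  have hcont : ContinuousAt β₂ ω₁ := (hc₂ ω₁ hω).continuousAt (Ioo_mem_nhds hω.1 hω.2)
  have hpos : 0 < β₂ ω₁ := (hs₂ ω₁ hω).1
  have hev : ∀ᶠ t in 𝓝[<] ω₁, β₂ t = β₁ t := by
    filter_upwards [Ioo_mem_nhdsLT hs1.2] with t ht
    exact (eqOn_of_mem Φ P hP hsplit hfin hgp hα₁ hc₁ hs₁ hc₂ hs₂ hs1 hs2 heq t
      ⟨max_lt (hs1.1.trans ht.1) (hs2.1.trans ht.1), lt_min ht.2 (ht.2.trans hlt)⟩).symm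
  have hlim : Tendsto β₁ (𝓝[<] ω₁) (𝓝 (β₂ ω₁)) :=
    (hcont.tendsto.mono_left nhdsWithin_le_nhds).congr' hev
  rcases hend with h0 | htop
  · exact hpos.ne' (tendsto_nhds_unique hlim h0)
  · exact not_tendsto_nhds_of_tendsto_atTop htop _ hlim

/-- **A left END cannot lie inside another solution through a common point** (mirror): if `β₁` on `(α₁, ω₁)` tends
to `0` or to `+∞` at `α₁⁺` and `β₂` is a continuous positive solution on `(α₂, ω₂)` agreeing with `β₁` at a common
point, then `α₁ ≤ α₂`. [folklore] -/
theorem alpha_le_of_leftEnd {α₁ ω₁ α₂ ω₂ : ℝ} {β₁ β₂ : ℝ → ℝ} (hα₁ : 0 ≤ α₁)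
    (hc₁ : ContinuousOn β₁ (Ioo α₁ ω₁)) (hs₁ : ∀ t ∈ Ioo α₁ ω₁, 0 < β₁ t ∧ MvPolynomial.eval ![t, β₁ t] Φ = 0)
    (hend : Tendsto β₁ (𝓝[>] α₁) (𝓝 0) ∨ Tendsto β₁ (𝓝[>] α₁) atTop)
    (hc₂ : ContinuousOn β₂ (Ioo α₂ ω₂)) (hs₂ : ∀ t ∈ Ioo α₂ ω₂, 0 < β₂ t ∧ MvPolynomial.eval ![t, β₂ t] Φ = 0)
    {s : ℝ} (hs1 : s ∈ Ioo α₁ ω₁) (hs2 : s ∈ Ioo α₂ ω₂) (heq : β₁ s = β₂ s) : α₁ ≤ α₂ := by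
  by_contra hlt
  push Not at hlt
  have hα : α₁ ∈ Ioo α₂ ω₂ := ⟨hlt, hs1.1.trans hs2.2⟩
  have hcont : ContinuousAt β₂ α₁ := (hc₂ α₁ hα).continuousAt (Ioo_mem_nhds hα.1 hα.2)
  have hpos : 0 < β₂ α₁ := (hs₂ α₁ hα).1
  have hev : ∀ᶠ t in 𝓝[>] α₁, β₂ t = β₁ t := by
    filter_upwards [Ioo_mem_nhdsGT hs1.1] with t ht
    exact (eqOn_of_mem Φ P hP hsplit hfin hgp hα₁ hc₁ hs₁ hc₂ hs₂ hs1 hs2 heq t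
      ⟨max_lt ht.1 (hlt.trans ht.1), lt_min (ht.2.trans hs1.2) (ht.2.trans hs2.2)⟩).symm
  have hlim : Tendsto β₁ (𝓝[>] α₁) (𝓝 (β₂ α₁)) :=
    (hcont.tendsto.mono_left nhdsWithin_le_nhds).congr' hev
  rcases hend with h0 | htop
  · exact hpos.ne' (tendsto_nhds_unique hlim h0)
  · exact not_tendsto_nhds_of_tendsto_atTop htop _ hlim

/-- **Two components sharing a point coincide** (piece (γ1), uniqueness).  Two components of the same horizon `B`
(continuous positive solutions on `(αᵢ, ωᵢ)`, `0 ≤ αᵢ`, `ωᵢ ≤ B`, right end ALIVE-at-`B` / ZERO / ESCAPE, left end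
REACHES-`0⁺` / ZERO / ESCAPE) that agree at one common point have `α₁ = α₂`, `ω₁ = ω₂`, and agree on `(α₁, ω₁)`.
[folklore] -/
theorem component_eq {B α₁ ω₁ α₂ ω₂ : ℝ} {β₁ β₂ : ℝ → ℝ} (hα₁ : 0 ≤ α₁) (hα₂ : 0 ≤ α₂)
    (hω₁ : ω₁ ≤ B) (hω₂ : ω₂ ≤ B)
    (hc₁ : ContinuousOn β₁ (Ioo α₁ ω₁)) (hs₁ : ∀ t ∈ Ioo α₁ ω₁, 0 < β₁ t ∧ MvPolynomial.eval ![t, β₁ t] Φ = 0)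
    (hR₁ : (ω₁ = B ∧ ContinuousOn β₁ (Ioc α₁ B) ∧ ∀ t ∈ Ioc α₁ B, 0 < β₁ t ∧ MvPolynomial.eval ![t, β₁ t] Φ = 0) ∨
      Tendsto β₁ (𝓝[<] ω₁) (𝓝 0) ∨ Tendsto β₁ (𝓝[<] ω₁) atTop)
    (hL₁ : α₁ = 0 ∨ Tendsto β₁ (𝓝[>] α₁) (𝓝 0) ∨ Tendsto β₁ (𝓝[>] α₁) atTop)
    (hc₂ : ContinuousOn β₂ (Ioo α₂ ω₂)) (hs₂ : ∀ t ∈ Ioo α₂ ω₂, 0 < β₂ t ∧ MvPolynomial.eval ![t, β₂ t] Φ = 0)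
    (hR₂ : (ω₂ = B ∧ ContinuousOn β₂ (Ioc α₂ B) ∧ ∀ t ∈ Ioc α₂ B, 0 < β₂ t ∧ MvPolynomial.eval ![t, β₂ t] Φ = 0) ∨
      Tendsto β₂ (𝓝[<] ω₂) (𝓝 0) ∨ Tendsto β₂ (𝓝[<] ω₂) atTop)
    (hL₂ : α₂ = 0 ∨ Tendsto β₂ (𝓝[>] α₂) (𝓝 0) ∨ Tendsto β₂ (𝓝[>] α₂) atTop)
    {s : ℝ} (hs1 : s ∈ Ioo α₁ ω₁) (hs2 : s ∈ Ioo α₂ ω₂) (heq : β₁ s = β₂ s) :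
    α₁ = α₂ ∧ ω₁ = ω₂ ∧ ∀ u ∈ Ioo α₁ ω₁, β₁ u = β₂ u := by
  have hω21 : ω₂ ≤ ω₁ := by
    rcases hR₁ with ⟨h1B, -, -⟩ | hend
    · rw [h1B]; exact hω₂
    · exact omega_le_of_rightEnd Φ P hP hsplit hfin hgp hα₁ hc₁ hs₁ hend hc₂ hs₂ hs1 hs2 heq
  have hω12 : ω₁ ≤ ω₂ := by
    rcases hR₂ with ⟨h2B, -, -⟩ | hend
    · rw [h2B]; exact hω₁
    · exact omega_le_of_rightEnd Φ P hP hsplit hfin hgp hα₂ hc₂ hs₂ hend hc₁ hs₁ hs2 hs1 heq.symm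
  have hα12 : α₁ ≤ α₂ := by
    rcases hL₁ with h10 | hend
    · rw [h10]; exact hα₂
    · exact alpha_le_of_leftEnd Φ P hP hsplit hfin hgp hα₁ hc₁ hs₁ hend hc₂ hs₂ hs1 hs2 heq
  have hα21 : α₂ ≤ α₁ := by
    rcases hL₂ with h20 | hend
    · rw [h20]; exact hα₁
    · exact alpha_le_of_leftEnd Φ P hP hsplit hfin hgp hα₂ hc₂ hs₂ hend hc₁ hs₁ hs2 hs1 heq.symm
  have hα : α₁ = α₂ := le_antisymm hα12 hα21
  have hω : ω₁ = ω₂ := le_antisymm hω12 hω21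
  refine ⟨hα, hω, fun u hu => ?_⟩
  refine eqOn_of_mem Φ P hP hsplit hfin hgp hα₁ hc₁ hs₁ hc₂ hs₂ hs1 hs2 heq u ?_
  rw [← hα, ← hω, max_self, min_self]
  exact hu

end

end OsculationPeel

end Summit.ValiantsHypothesis.ValiantsHypothesis.Theorems.LacunarySymmetroidMatrixDescartes

end
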